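import Summits.AtomisticToContinuum.BoseEinsteinCondensation.Theorems.BECThomsonPrincipleGDTransferSeededCompactClosed

/-!
# SKELETON v8.2 of the line `seeded-continuity` (lead `prover-line-…-c4`, 2026-08-17) — crux `GDTransfer`
# (stmt-AtomisticToContinuum-9482), route BECThomsonPrinciple

v8.2 = v8.1 (text only: stubs unchanged) after waves 2–3. v8.1 = v8 with the five stubs of the compactness transport LANDED in wave 1 (`stub_energyUpperL1` p163618,
`stub_aeDilationL1` p163569, `stub_compactLimitAE` p163701, `stub_dilateCompactL1` p163577, `stub_localConstancyL1`
p163655; Defs `…SeededCompactDefs` p162740), composed in `…SeededCompactClosed` (p164122: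
`integrable_periodicBEC_of_seed`, `essIntegrable_periodicBEC_of_seed`, `localConstancy_of_integrable`,
`GDTransfer_of_seed_of_nonIntegrableRest`).  RESULT: given the seed, Gaussian domination implies periodic BEC for
EVERY admissible profile with `∫_{ℝ³} v(|x|) dx < ∞` (the Born-finite = Fournais class; discontinuous and unbounded
integrable cores included).  `sorry` lives exactly in the TWO registered stubs below; `GDTransfer_holds_of_stubs`
concludes the crux BY NAME.
Sizes: `stub_noBalancedCat` — the SEED (open-problem-sized uniformly in `N`; fixed-`N` form proved p150446; SPECTRAL
form, lead c4: `NoBalancedCatFor v ⟸ KyFanGapFloorFor v` — a Ky Fan gap floor `K/L³` on the dilute path — Defs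
`…SeededSpectralDefs` p164024, sub-goals smoothBlockAlgebra / smoothSplitting / pinchingBound / catKyFan /
seedFor_of_kyFanGapFloor ALL LANDED, composition `…SeededSpectralClosed` p165997: `periodicBEC_of_gd_of_kyFanGapFloor`; integrable
twins (Defs `…SeededSpectralIntDefs` p165276) LANDED, composition `…SeededSpectralIntClosed` p166927:
`integrable_periodicBEC_of_gd_of_kyFanGapFloor` — GD + gap floor ⇒ periodic BEC for exactly this skeleton's soft class; sanity of the gap
floor p165497 (v = 0) and p165669 (beyond the far corner)); `stub_nonIntegrableRest` — crux-sized (the Born-infinite class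
`∫ v(|x|)dx = ∞`: hard cores on positive measure, non-integrable soft cores; plain witnesses have `⊤` energy —
dressing; two-sided local constancy at hard cores ⇐ LemmaGConnected, avoidable by a one-sided glue, card v8).
History: v4 (c1) tree-technology stubs; v5 (c2) `stub_roughNull`, fixed-N seed; v6 (c3, wave 1) essentially bounded
class; v7 (c3, wave 2) finite + square-integrable lift; v8/v8.1 (c4) finite + integrable lift by compactness transport.
-/

noncomputable section

namespace Summit.AtomisticToContinuum.BoseEinsteinCondensation.Cruxes.GDTransfer.Seeded

open Summit.AtomisticToContinuum.BoseEinsteinCondensation.Theses.BECThomsonPrinciple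

/-! ## Registered stubs (sorried) -/

/-- `stub_noBalancedCat` [the SEED; open-problem-sized uniformly in `N`; = prepared sub-crux `NoBalancedCat` verbatim]:
along the density path the `n̂₀`-law of a near-minimiser is never split `≥ τ` / `≥ τ` between `{n̂₀ < θN}` and
`{n̂₀ ≥ (1−β)N}`, with `τ < 1/2` chosen BEFORE `N`.  Spectral form (c4): implied at each finite continuous `v` by a
Ky Fan gap floor `K/L³` on the dilute path (`seedFor_of_kyFanGapFloor`). -/
theorem stub_noBalancedCat : Sig.stub_noBalancedCat := by
  sorry

/-- `stub_nonIntegrableRest` [crux-sized]: the Born-infinite class `∫_{ℝ³} v(|x|) dx = ∞` (hard cores on positive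
measure, non-integrable soft cores), given GD, the seed and periodic BEC for the integrable class. -/
theorem stub_nonIntegrableRest : Sig.stub_nonIntegrableRest := by
  sorry

/-! ## Composition (sorry-free given the stubs) -/

/-- **The crux from the two registered stubs and the landed theorems** (sorries live only inside `stub_*`):
through the landed glue `GDTransfer_of_seed_of_nonIntegrableRest` (…SeededCompactClosed p164122). -/
theorem GDTransfer_holds_of_stubs : GDTransfer :=
  GDTransfer_of_seed_of_nonIntegrableRest stub_noBalancedCat stub_nonIntegrableRest

end Summit.AtomisticToContinuum.BoseEinsteinCondensation.Cruxes.GDTransfer.Seeded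

end
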